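import Mathlib
import Literature.MathematicalPhysics.MHD.BallooningSAlphaMarginalShear
import HarnessLib

/-!
# THE QUARTER STRIP `|α − s| ≤ √s/4` AROUND THE DIAGONAL IS UNSTABLE FOR EVERY `s ≥ 25`; hence
# `s − 2√s ≤ α₁(s) < s − √s/4` (`s ≥ 25`) and `α + √α/4 ≤ s₊(α) ≤ α + 2√α` (`α ≥ 25`) — both edges of the certified
# `√`-sandwich now have explicit constants `2` and `1/4` (Freidberg, *Ideal MHD* §12.6.2 (12.100); Fundamenski §4.2.4 (4.159), (4.162))

Topic `Literature/MathematicalPhysics/MHD` (namespace = path; sub-namespace `Ballooning.SAlpha`).  Written for the venture ladder GRIDFUSION,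
rung F3, by gridfusion-lit-3 (g15), 2026-08-28, over `BallooningSAlphaDiagonalUnstable.lean` (`halfWaveBoundExact`, `energy_halfWave_le_exact`,
`unstableWitness_halfWave_exact`: the half-cosine with the curvature integral kept exact), `BallooningSAlphaFirstRegionSqrt.lean`
(`sub_two_sqrt_le_firstCritical`) and `BallooningSAlphaMarginalShear.lean` (`upperMarginalShear`) BY IMPORT.  It sharpens lit-3's strip
`|α − s| ≤ √s/10` (`s ≥ 16`, `BallooningSAlphaZeroLocalShear.lean`, ★ #317) to `√s/4` (`s ≥ 25`) with the half-width `L = 5/(2√s)`.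
0 named facts, 0 kit, no `decide`.

## What is PROVED (everything; 0 facts)
* §1 ★ `halfWaveBoundExact_quarterStrip_le` — for `r = √s ≥ 5` and `|s − α| ≤ r/4`:
  `B′(s, α, 5/2r)·r ≤ r²(π²/10 + 5π²/96 − 5/2) + r(125/48 + 5/8) + 3125π²/8064 + 125/192 + 125/48` (`< 0` for `r ≥ 5`, `π < 3.15`).
* §2 ★★ `unstableWitness_halfWave_quarterStrip`, ★★★ `not_stableSide_quarterStrip` — for every `s ≥ 25` and every `α` with
  `|α − s| ≤ √s/4`, `(s, α)` is off the stable side.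
* §3 ★★★ `firstCritical_mem_Ico_quarter` — `s − 2√s ≤ α₁(s) < s − √s/4` for `s ≥ 25`; ★★★ `upperMarginalShear_mem_Icc_quarter` —
  `α + √α/4 ≤ s₊(α) ≤ α + 2√α` for `α ≥ 25`.
THREE COLUMNS.  CERTIFIED: the strip and the two sandwiches, about the MODEL (one-surface Newcomb sense, `θ₀ = 0`).  VALIDATED: float
`s − α₁(s) = 5.5, 7.0, 9.9, 12.8` at `s = 25, 36, 64, 100` (edge1.py) vs certified `[√s/4, 2√s] = [1.25, 10], [1.5, 12], [2, 16], [2.5, 20]`.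
NOT CLAIMED: the constants are not optimal (the half-cosine bound itself reaches `≈ 0.28√s` at `s = 25`, `≈ 0.43√s` at `s = 400`; the
true gap grows like `≈ 1.3√s`).

## Sources
* J. P. Freidberg, *Ideal MHD*, CUP 2014 [Freidberg2014] §12.6.2 eqs. (12.97)–(12.100) [corpus: book:freidbergnd-ideal-mhd p0532–p0533].
* W. Fundamenski, *Power Exhaust in Fusion Plasmas*, CUP 2009 [Fundamenski2009] §4.2.4 eqs. (4.159)–(4.162) [corpus: p0170–p0171].
-/

noncomputable section

open Real Set Filter

namespace Literature.MathematicalPhysics.MHD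

namespace Ballooning

namespace SAlpha

/-! ## §1 The bound on the quarter strip -/

/-- [folklore] `θ − θ³/6 ≤ sin θ` for `θ ≥ 0`. -/
private theorem sub_cube_le_sin'' {θ : ℝ} (hθ : 0 ≤ θ) : θ - θ ^ 3 / 6 ≤ Real.sin θ := by
  let h : ℝ → ℝ := fun t => Real.sin t - t + t ^ 3 / 6
  have hd : ∀ t, HasDerivAt h (Real.cos t - 1 + t ^ 2 / 2) t := by
    intro t
    have h1 := ((Real.hasDerivAt_sin t).sub (hasDerivAt_id t)).add (((hasDerivAt_id t).pow 3).div_const 6)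
    refine h1.congr_deriv ?_
    simp only [id, Nat.cast_ofNat]
    ring
  have hmono : MonotoneOn h (Ici 0) := by
    refine monotoneOn_of_deriv_nonneg (convex_Ici 0) ?_ ?_ ?_
    · exact (continuous_iff_continuousAt.2 fun t => (hd t).continuousAt).continuousOn
    · exact fun t _ => (hd t).differentiableAt.differentiableWithinAt
    · intro t _
      rw [(hd t).deriv]
      linarith [Real.one_sub_sq_div_two_le_cos (x := t)]
  have := hmono (mem_Ici.2 le_rfl) (mem_Ici.2 hθ) hθ
  simp only [h, Real.sin_zero] at this
  linarith

/-- ★ ON THE QUARTER STRIP, with `r = √s ≥ 5`, `L = 5/(2r)` and `|s − α| ≤ r/4`: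
`B′(s, α, 5/2r)·r ≤ r²(π²/10 + 5π²/96 − 5/2) + r(125/48 + 5/8) + (3125π²/8064 + 125/192 + 125/48)`
(`(s − α)² ≤ r²/16`, `α|s − α| ≤ (r² + r/4)·r/4`, `α sin L·(1 + 1/(4k² − 1)) ≥ (r² − r/4)(L − L³/6)`).
[cite: Freidberg2014, §12.6.2 eq. (12.97)] -/
theorem halfWaveBoundExact_quarterStrip_le {s α r : ℝ} (hr : 5 ≤ r) (hrs : r ^ 2 = s) (hδ : |s - α| ≤ r / 4) :
    halfWaveBoundExact s α (5 / (2 * r)) * r ≤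
      r ^ 2 * (π ^ 2 / 10 + 5 * π ^ 2 / 96 - 5 / 2) + r * (125 / 48 + 5 / 8)
        + (3125 * π ^ 2 / 8064 + 125 / 192 + 125 / 48) := by
  have hr0 : 0 < r := by linarith
  have hrne : r ≠ 0 := hr0.ne'
  have hπ3 := Real.pi_gt_three
  have hα1 : r ^ 2 - r / 4 ≤ α := by have := (abs_le.1 hδ).2; nlinarith
  have hα2 : α ≤ r ^ 2 + r / 4 := by have := (abs_le.1 hδ).1; nlinarith
  have hα0 : 0 ≤ α := by nlinarith
  have hd2 : (s - α) ^ 2 ≤ r ^ 2 / 16 := by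
    have := sq_abs (s - α)
    nlinarith [abs_nonneg (s - α)]
  have habs : 0 ≤ |s - α| := abs_nonneg _
  -- the wavenumber and the exact-curvature factor
  have hk : π / (2 * (5 / (2 * r))) = π * r / 5 := by field_simp
  obtain ⟨c, hc⟩ : ∃ c : ℝ, 1 + 1 / (4 * (π / (2 * (5 / (2 * r)))) ^ 2 - 1) = c := ⟨_, rfl⟩
  have hc1 : 1 ≤ c := by
    rw [← hc, hk]
    have hπr : 15 ≤ π * r := by nlinarith
    have h4 : 0 < 4 * (π * r / 5) ^ 2 - 1 := by nlinarith
    have := one_div_pos.2 h4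
    linarith
  -- the sine bound
  have hL0 : 0 < 5 / (2 * r) := by positivity
  have hsin : 5 / (2 * r) - (5 / (2 * r)) ^ 3 / 6 ≤ Real.sin (5 / (2 * r)) := sub_cube_le_sin'' hL0.le
  have hsin0 : 0 ≤ Real.sin (5 / (2 * r)) := by
    refine Real.sin_nonneg_of_nonneg_of_le_pi hL0.le ?_
    rw [div_le_iff₀ (by positivity)]; nlinarith
  -- split off the curvature term
  have hB : halfWaveBoundExact s α (5 / (2 * r))
      = (π / (2 * (5 / (2 * r)))) ^ 2 * (5 / (2 * r))
        + (π / (2 * (5 / (2 * r)))) ^ 2 * (s ^ 2 * (5 / (2 * r)) ^ 7 / 63 + 4 / 3 * (s - α) ^ 2 * (5 / (2 * r)) ^ 3)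
        + 2 / 3 * α * |s - α| * (5 / (2 * r)) ^ 3 - α * Real.sin (5 / (2 * r)) * c := by
    rw [halfWaveBoundExact, hc]
  -- the explicit (α-free) part times r
  have t1 : ((π / (2 * (5 / (2 * r)))) ^ 2 * (5 / (2 * r))
      + (π / (2 * (5 / (2 * r)))) ^ 2 * ((r ^ 2) ^ 2 * (5 / (2 * r)) ^ 7 / 63 + 4 / 3 * (s - α) ^ 2 * (5 / (2 * r)) ^ 3)) * r
      = π ^ 2 * r ^ 2 / 10 + 3125 * π ^ 2 / 8064 + 5 * π ^ 2 * (s - α) ^ 2 / 6 := by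
    field_simp
    ring
  have t2 : 2 / 3 * α * |s - α| * (5 / (2 * r)) ^ 3 * r = 125 / 12 * (α * |s - α|) / r ^ 2 := by
    field_simp
    ring
  -- bounds
  have e1 : 5 * π ^ 2 * (s - α) ^ 2 / 6 ≤ 5 * π ^ 2 * (r ^ 2 / 16) / 6 := by gcongr
  have e2 : 125 / 12 * (α * |s - α|) / r ^ 2 ≤ 125 / 12 * ((r ^ 2 + r / 4) * (r / 4)) / r ^ 2 := by
    have hm : α * |s - α| ≤ (r ^ 2 + r / 4) * (r / 4) := mul_le_mul hα2 hδ habs (by positivity)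
    have h' : 125 / 12 * (α * |s - α|) ≤ 125 / 12 * ((r ^ 2 + r / 4) * (r / 4)) := by linarith
    exact div_le_div_of_nonneg_right h' (by positivity)
  have e2' : 125 / 12 * ((r ^ 2 + r / 4) * (r / 4)) / r ^ 2 = 125 / 48 * r + 125 / 192 := by
    field_simp
    ring
  have e3 : (r ^ 2 - r / 4) * (5 / (2 * r) - (5 / (2 * r)) ^ 3 / 6) ≤ α * Real.sin (5 / (2 * r)) * c := by
    have h1 : (r ^ 2 - r / 4) * (5 / (2 * r) - (5 / (2 * r)) ^ 3 / 6) ≤ α * (5 / (2 * r) - (5 / (2 * r)) ^ 3 / 6) := by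
      have hpos : 0 ≤ 5 / (2 * r) - (5 / (2 * r)) ^ 3 / 6 := by
        have hL1 : 5 / (2 * r) ≤ 1 := by rw [div_le_one (by positivity)]; linarith
        have hL3 : (5 / (2 * r)) ^ 3 ≤ 5 / (2 * r) := pow_le_of_le_one hL0.le hL1 (by norm_num)
        linarith
      exact mul_le_mul_of_nonneg_right hα1 hpos
    have h2 : α * (5 / (2 * r) - (5 / (2 * r)) ^ 3 / 6) ≤ α * Real.sin (5 / (2 * r)) := mul_le_mul_of_nonneg_left hsin hα0
    have h3 : α * Real.sin (5 / (2 * r)) * 1 ≤ α * Real.sin (5 / (2 * r)) * c :=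
      mul_le_mul_of_nonneg_left hc1 (mul_nonneg hα0 hsin0)
    linarith
  have e3' : (r ^ 2 - r / 4) * (5 / (2 * r) - (5 / (2 * r)) ^ 3 / 6) * r
      = 5 / 2 * r ^ 2 - 5 / 8 * r - 125 / 48 + 125 / (192 * r) := by
    field_simp
    ring
  have e4 : 0 ≤ 125 / (192 * r) := by positivity
  -- assemble
  have hmain : halfWaveBoundExact s α (5 / (2 * r)) * r
      = ((π / (2 * (5 / (2 * r)))) ^ 2 * (5 / (2 * r))
        + (π / (2 * (5 / (2 * r)))) ^ 2 * ((r ^ 2) ^ 2 * (5 / (2 * r)) ^ 7 / 63 + 4 / 3 * (s - α) ^ 2 * (5 / (2 * r)) ^ 3)) * r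
        + 2 / 3 * α * |s - α| * (5 / (2 * r)) ^ 3 * r - α * Real.sin (5 / (2 * r)) * c * r := by
    rw [hB, ← hrs]; ring
  rw [hmain, t1, t2]
  have e3r := mul_le_mul_of_nonneg_right e3 hr0.le
  rw [e3'] at e3r
  rw [e2'] at e2
  nlinarith [e1, e2, e3r, e4, sq_nonneg π]

/-! ## §2 The quarter strip is unstable -/

/-- ★★ THE HALF-COSINE OF HALF-WIDTH `5/(2√s)` IS AN INSTABILITY WITNESS ON THE QUARTER STRIP: `s ≥ 25`, `|α − s| ≤ √s/4`.
[cite: Freidberg2014, §12.6.2 eqs. (12.97)–(12.100)] with [Fundamenski2009] §4.2.4 (4.160)–(4.162) -/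
theorem unstableWitness_halfWave_quarterStrip {s α : ℝ} (hs : 25 ≤ s) (hα : |α - s| ≤ Real.sqrt s / 4) :
    UnstableWitness s α (-(5 / (2 * Real.sqrt s))) (5 / (2 * Real.sqrt s))
      (halfWave (5 / (2 * Real.sqrt s))) (halfWaveDeriv (5 / (2 * Real.sqrt s))) := by
  obtain ⟨r, hr⟩ : ∃ r : ℝ, Real.sqrt s = r := ⟨_, rfl⟩
  have hs0 : 0 ≤ s := by linarith
  have hrs : r ^ 2 = s := by rw [← hr]; exact Real.sq_sqrt hs0
  have hrpos : 0 < r := by rw [← hr]; exact Real.sqrt_pos.2 (by linarith)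
  have hr5 : 5 ≤ r := by nlinarith
  rw [hr] at hα ⊢
  have hδ : |s - α| ≤ r / 4 := by rwa [abs_sub_comm] at hα
  have hα0 : 0 ≤ α := by have := (abs_le.1 hδ).2; nlinarith
  have hL : 0 < 5 / (2 * r) := by positivity
  have hLπ : 5 / (2 * r) < π := by
    rw [div_lt_iff₀ (by positivity)]; nlinarith [Real.pi_gt_three]
  refine unstableWitness_halfWave_exact hs0 hα0 hL hLπ ?_
  have h := halfWaveBoundExact_quarterStrip_le hr5 hrs hδ
  have hπ := Real.pi_lt_d2
  have hπ0 := Real.pi_pos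
  have hπ2 : π ^ 2 < 3.15 ^ 2 := by nlinarith
  have hq : 5 * r ≤ r ^ 2 := by nlinarith
  have hneg : halfWaveBoundExact s α (5 / (2 * r)) * r < 0 := by
    have hc : r ^ 2 * (π ^ 2 / 10 + 5 * π ^ 2 / 96 - 5 / 2) ≤ r ^ 2 * (3.15 ^ 2 / 10 + 5 * 3.15 ^ 2 / 96 - 5 / 2) := by
      have : π ^ 2 / 10 + 5 * π ^ 2 / 96 - 5 / 2 ≤ 3.15 ^ 2 / 10 + 5 * 3.15 ^ 2 / 96 - 5 / 2 := by nlinarith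
      exact mul_le_mul_of_nonneg_left this (sq_nonneg r)
    nlinarith [h, hc, hq, hπ2]
  by_contra hge
  push Not at hge
  have := mul_nonneg hge hrpos.le
  linarith

/-- ★★★ THE QUARTER STRIP IS OFF THE STABLE SIDE: for every `s ≥ 25` and every `α` with `|α − s| ≤ √s/4`, `¬ StableSide s α`.
[cite: Freidberg2014, §12.6.2 eqs. (12.97)–(12.100)] with [Fundamenski2009] §4.2.4 («in which `α` and `s` are comparable, is the domain of
ballooning instabilities») -/
theorem not_stableSide_quarterStrip {s α : ℝ} (hs : 25 ≤ s) (hα : |α - s| ≤ Real.sqrt s / 4) : ¬ StableSide s α :=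
  fun h => h _ _ _ _ (unstableWitness_halfWave_quarterStrip hs hα)

/-! ## §3 The sharpened sandwiches -/

/-- ★★ `α₁(s) < s − √s/4` for `s ≥ 25`. [cite: Freidberg2014, §12.6.2 eq. (12.100)] -/
theorem firstCritical_lt_sub_sqrt_quarter {s : ℝ} (hs : 25 ≤ s) : firstCritical s < s - Real.sqrt s / 4 := by
  have hs0 : 0 < s := by linarith
  have hsq : Real.sqrt s ≤ s := by
    calc Real.sqrt s ≤ Real.sqrt (s ^ 2) := Real.sqrt_le_sqrt (by nlinarith)
      _ = s := Real.sqrt_sq hs0.le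
  have hβ0 : 0 ≤ s - Real.sqrt s / 4 := by linarith
  have hβ : ¬ StableSide s (s - Real.sqrt s / 4) := not_stableSide_quarterStrip hs (by
    rw [show s - Real.sqrt s / 4 - s = -(Real.sqrt s / 4) by ring, abs_neg, abs_of_nonneg (by positivity)])
  exact firstCritical_lt_of_not_stableSide hs0 hβ0 hβ

/-- ★★★ THE SHARPENED `√`-SANDWICH: for every `s ≥ 25`, `s − 2√s ≤ α₁(s) < s − √s/4`.
[cite: Freidberg2014, §12.6.2 eq. (12.100)] with [Fundamenski2009] §4.2.4 (4.162) -/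
theorem firstCritical_mem_Ico_quarter {s : ℝ} (hs : 25 ≤ s) :
    firstCritical s ∈ Ico (s - 2 * Real.sqrt s) (s - Real.sqrt s / 4) :=
  ⟨sub_two_sqrt_le_firstCritical (by linarith), firstCritical_lt_sub_sqrt_quarter hs⟩

/-- For `α ≥ 25` the shear `α + √α/4` is unstable. [cite: Freidberg2014, §12.6.2 eqs. (12.97)–(12.100)] -/
theorem add_sqrt_quarter_mem_unstableShearSet {α : ℝ} (hα : 25 ≤ α) : α + Real.sqrt α / 4 ∈ unstableShearSet α := by
  have hq := Real.sqrt_nonneg α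
  have hs : 25 ≤ α + Real.sqrt α / 4 := by linarith
  refine not_stableSide_quarterStrip hs ?_
  have hmono : Real.sqrt α ≤ Real.sqrt (α + Real.sqrt α / 4) := Real.sqrt_le_sqrt (by linarith)
  rw [show α - (α + Real.sqrt α / 4) = -(Real.sqrt α / 4) by ring, abs_neg, abs_of_nonneg (by positivity)]
  linarith

/-- ★★★ `α + √α/4 ≤ s₊(α) ≤ α + 2√α` for every `α ≥ 25`. [cite: Fundamenski2009, §4 eq. (4.159)] with [Freidberg2014] §12.6.2 (12.100) -/
theorem upperMarginalShear_mem_Icc_quarter {α : ℝ} (hα : 25 ≤ α) :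
    upperMarginalShear α ∈ Icc (α + Real.sqrt α / 4) (α + 2 * Real.sqrt α) :=
  ⟨le_csSup (bddAbove_unstableShearSet (by linarith)) (add_sqrt_quarter_mem_unstableShearSet hα),
    upperMarginalShear_le (by linarith)⟩

end SAlpha

end Ballooning

end Literature.MathematicalPhysics.MHD

end
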